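import Summits.HodgeConjecture.CorCM.AndreWeakFormProducts
import Summits.HodgeConjecture.HodgeConjecture.Theorems.CorCMDomination
import HarnessLib

/-!
# COR-CM (cell `pub-hodgecm2`): the WEAK André record from a domination by CM-typed biproducts over one
# Galois CM field (kernel, record-free assembly)

HONEST FRAMING (cell pub-hodgecm2 / COR-CM, literature seat André, gen 3): a STRUCTURE statement about the
Hodge ring of complex abelian varieties of CM type on the tree's real carriers; no case of the Hodge
conjecture is proved and nothing about algebraic cycles is asserted. This file is the record-free
ASSEMBLY of the derivation of the Literature record
`HodgeTheory.Andre1992_hodgeClasses_cmAbelianVariety_mem_span_pullback_weilClasses`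
(`Literature/AlgebraicGeometry/HodgeTheory/WeilClassesCMReduction.lean`; André 1992 = Charles–Schnell 2014
Thm. 11.5.21 = Milne's endnote M.12 to Deligne 1982; a hypothesis `(h𝔄 : …)` of the ring-2 theorems
`Theorems/Ring2Hypotheses.lean` and of some forty other files) from ONE explicit input, «we may suppose
that `A` is a product»:

* `weakTargets_pullback_stable` — the record's two-member target family (pull-backs of rational `(k,k)`
  Weil classes of an imaginary quadratic field / of a CM field `ℚ(ψ) ≅ ℚ[T]/(P)` of degree `e > 2`) is
  stable under further pull-back;
* **`andre1992_weak_of_domination`** — IF every complex abelian variety of CM type (`Milne1999.IsOfCMType`,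
  the record's hypothesis symbol by symbol) is dominated (`s ≫ π = [N]_A`, `N ≠ 0`,
  `CorCM.Domination.AVDominatedBy`) by a finite biproduct of realisations of CM types of ONE Galois CM
  field `F` with `2 < [F:ℚ]`, THEN the record holds — the product case is André's trick in the record's
  vocabulary (`AndreWeakForm.andreWeak_cmTypedProduct`, kernel, on seat gen 2's
  `AndreProductForm.…weilLines_holds`), descended along the retraction (`AndreWeakForm.mem_span_of_retraction`).

The domination input is discharged elsewhere in the cell, in three strengths: from Riemann's theorem
`DeligneMilne1982_Thm_6_20_full` with the records `hU`, `h₃`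
(`Domination.exists_avDominatedBy_biproduct_realisations_of_riemann`, seat b18), with `h₃` only
(`Domination.cmDominated_of_isOfCMType_of_riemann`, seat lit-milne — whose `CorCM/Milne2020OfRiemannRealised`
already derives the record modulo `hR`, `h₃` by Milne's route), and from Riemann's theorem ALONE
(`AndreRiemann.exists_avDominatedBy_biproduct_realisations_of_riemann'`, seat b24: Poincaré + Shimura §5–§7
inflation `B ⊗_{K₀} L` made principal) — the last one, composed with `andre1992_weak_of_domination`, is
the companion file `CorCM/AndreWeakFormOfRiemann.lean`.

References: [Andre1992HodgeCM] Théorème (pp. 4–5), p. 2; [CharlesSchnell2014Notes] Thm. 11.5.21 and proof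
(pp. 510–511: «`E` the Galois closure of the compositum … `V_α := ⊕_{(i,g)∈α} E_{gφ_i}`»);
[Deligne1982HodgeCycles] endnote M.12 (p. 64); [Milne2020HodgeClassesAV] §3 Thm. 1 and proof («We may
suppose that A is a product»); [MumfordAV1970] §19.
-/

noncomputable section

namespace Summit.HodgeConjecture.CorCM.AndreWeakForm

open CategoryTheory CategoryTheory.Limits NumberField Polynomial
open Literature.AlgebraicGeometry Literature.AlgebraicGeometry.Motives Literature.AlgebraicGeometry.HodgeTheory
open Literature.AlgebraicGeometry.ComplexMultiplication Literature.AlgebraicGeometry.Milne1999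
open Summit.HodgeConjecture.CorCM.Domination

/-! ## The record's target family is stable under pull-backs -/

/-- The two-member target family of the weak André record at a complex abelian variety `X` — pull-backs
`g^*(w)` of rational `(k,k)` Weil classes of an imaginary quadratic field (`weilClassesOf`) or of a CM
field `ℚ(ψ) ≅ ℚ[T]/(P)` of degree `e > 2` (`weilClassesField`) — is stable under further pull-back along
any `ℂ`-morphism `Y.X ⟶ X.X` (`(g' ≫ g)^* w = g'^* g^* w`). The family is spelled out verbatim (no
definition is introduced). [cite: CharlesSchnell2014Notes, Thm. 11.5.21 (p. 510)] -/
theorem weakTargets_pullback_stable (k : ℕ) (X Y : AbelianVariety ℂ) (g : X.X ⟶ Y.X)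
    (w : complexBetti Y.X (2 * k))
    (hw : w ∈
      ({c' : complexBetti Y.X (2 * k) |
          ∃ (B : Motives.AbelianVariety ℂ) (g : Y.X ⟶ B.X) (d : ℕ) (ψ : B ⟶ B)
            (w : complexBetti B.X (2 * k)),
            B.dim = 2 * k ∧ 0 < d ∧ ψ ≫ ψ = -(d • 𝟙 B) ∧ IsRationalClass w ∧
              IsOfHodgeType (2 * k) B.X (2 * k) k k w ∧ w ∈ weilClassesOf B ψ k d ∧
              c' = complexBetti.map g (2 * k) w} ∪
       {c' : complexBetti Y.X (2 * k) |
          ∃ (B : Motives.AbelianVariety ℂ) (g : Y.X ⟶ B.X) (ψ : B ⟶ B) (P : Polynomial ℤ) (e : ℕ)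
            (w : complexBetti B.X (2 * k)),
            P.Monic ∧ P.natDegree = e ∧ 2 < e ∧ Irreducible (P.map (Int.castRingHom ℚ)) ∧
              Polynomial.eval₂ (Int.castRingHom (CategoryTheory.End B)) (ψ : CategoryTheory.End B) P = 0 ∧
              e * (2 * k) = 2 * B.dim ∧
              (∀ ρ : ℂ, Polynomial.eval₂ (Int.castRingHom ℂ) ρ P = 0 → starRingEnd ℂ ρ ≠ ρ) ∧
              (∃ Q : Polynomial ℚ, ∀ ρ : ℂ, Polynomial.eval₂ (Int.castRingHom ℂ) ρ P = 0 →
                  Polynomial.eval₂ (algebraMap ℚ ℂ) ρ Q = starRingEnd ℂ ρ) ∧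
              w ∈ weilClassesField B ψ P (2 * k) ∧ IsRationalClass w ∧
              IsOfHodgeType B.dim B.X (2 * k) k k w ∧ c' = complexBetti.map g (2 * k) w})) :
    complexBetti.map g (2 * k) w ∈
      ({c' : complexBetti X.X (2 * k) |
          ∃ (B : Motives.AbelianVariety ℂ) (g : X.X ⟶ B.X) (d : ℕ) (ψ : B ⟶ B)
            (w : complexBetti B.X (2 * k)),
            B.dim = 2 * k ∧ 0 < d ∧ ψ ≫ ψ = -(d • 𝟙 B) ∧ IsRationalClass w ∧
              IsOfHodgeType (2 * k) B.X (2 * k) k k w ∧ w ∈ weilClassesOf B ψ k d ∧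
              c' = complexBetti.map g (2 * k) w} ∪
       {c' : complexBetti X.X (2 * k) |
          ∃ (B : Motives.AbelianVariety ℂ) (g : X.X ⟶ B.X) (ψ : B ⟶ B) (P : Polynomial ℤ) (e : ℕ)
            (w : complexBetti B.X (2 * k)),
            P.Monic ∧ P.natDegree = e ∧ 2 < e ∧ Irreducible (P.map (Int.castRingHom ℚ)) ∧
              Polynomial.eval₂ (Int.castRingHom (CategoryTheory.End B)) (ψ : CategoryTheory.End B) P = 0 ∧
              e * (2 * k) = 2 * B.dim ∧
              (∀ ρ : ℂ, Polynomial.eval₂ (Int.castRingHom ℂ) ρ P = 0 → starRingEnd ℂ ρ ≠ ρ) ∧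
              (∃ Q : Polynomial ℚ, ∀ ρ : ℂ, Polynomial.eval₂ (Int.castRingHom ℂ) ρ P = 0 →
                  Polynomial.eval₂ (algebraMap ℚ ℂ) ρ Q = starRingEnd ℂ ρ) ∧
              w ∈ weilClassesField B ψ P (2 * k) ∧ IsRationalClass w ∧
              IsOfHodgeType B.dim B.X (2 * k) k k w ∧ c' = complexBetti.map g (2 * k) w}) := by
  rcases hw with ⟨B, g', d, ψ, w', h1, h2, h3, h4, h5, h6, rfl⟩ |
    ⟨B, g', ψ, P, e, w', h1, h2, h3, h4, h5, h6, h7, h8, h9, h10, h11, rfl⟩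
  · exact Or.inl ⟨B, g ≫ g', d, ψ, w', h1, h2, h3, h4, h5, h6,
      by rw [complexBetti.map_comp, ModuleCat.comp_apply]⟩
  · exact Or.inr ⟨B, g ≫ g', ψ, P, e, w', h1, h2, h3, h4, h5, h6, h7, h8, h9, h10, h11,
      by rw [complexBetti.map_comp, ModuleCat.comp_apply]⟩

/-! ## The weak André record from a domination by CM-typed biproducts over one Galois CM field -/

/-- **Assembly over an abstract domination hypothesis.** If every complex abelian variety of CM type
(`Milne1999.IsOfCMType`, = the record's hypothesis symbol by symbol) is dominated — `s : A → ⨁ B`,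
`π : ⨁ B → A`, `π ∘ s = [N]_A`, `N ≠ 0` — by a finite biproduct of realisations `(B_i, ι_i, θ_i)` of CM
types of ONE Galois CM field `F` with `2 < [F:ℚ]`, then the weak André record
`HodgeTheory.Andre1992_hodgeClasses_cmAbelianVariety_mem_span_pullback_weilClasses` holds: the product
case `AndreWeakForm.andreWeak_cmTypedProduct` (André's trick, kernel) descends along the retraction
(`AndreWeakForm.mem_span_of_retraction`, the record's target family being pull-back stable,
`weakTargets_pullback_stable`). «We may suppose that `A` is such a product» is thereby an explicit,
separately dischargeable input. [cite: CharlesSchnell2014Notes, Thm. 11.5.21 and proof (pp. 510–511)]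
[cite: Milne2020HodgeClassesAV, §3 Thm. 1 and proof («We may suppose that A is a product»)] -/
theorem andre1992_weak_of_domination
    (hdom : ∀ A : AbelianVariety ℂ, IsOfCMType A →
      ∃ (F : Type) (_ : Field F) (_ : NumberField F) (_ : IsCMField F),
        IsGalois ℚ F ∧ 2 < Module.finrank ℚ F ∧
          ∃ (n : ℕ) (B : Fin n → AbelianVariety ℂ) (Φ : Fin n → CMType F)
            (ι : ∀ i, 𝓞 F →+* End (B i)) (θ : ∀ i, F →+* Module.End ℂ (complexBetti (B i).X 1)),
            (∀ i, IsCMTypeRealisation (Φ i) (B i) (ι i) (θ i)) ∧ AVDominatedBy A (⨁ B)) :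
    Andre1992_hodgeClasses_cmAbelianVariety_mem_span_pullback_weilClasses := by
  intro A _hX hCM k c hcQ hcH
  classical
  obtain ⟨F, _instF, _instNF, _instCM, hGal, hF, n, B, Φ, ι, θ, hB, s, π, N, hN, hsπ⟩ := hdom A hCM
  haveI : IsGalois ℚ F := hGal
  -- transfer of the product case along the retraction `s ≫ π = [N]`
  exact mem_span_of_retraction (k := k)
    (fun X : AbelianVariety ℂ =>
      ({c' : complexBetti X.X (2 * k) |
          ∃ (B : Motives.AbelianVariety ℂ) (g : X.X ⟶ B.X) (d : ℕ) (ψ : B ⟶ B)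
            (w : complexBetti B.X (2 * k)),
            B.dim = 2 * k ∧ 0 < d ∧ ψ ≫ ψ = -(d • 𝟙 B) ∧ IsRationalClass w ∧
              IsOfHodgeType (2 * k) B.X (2 * k) k k w ∧ w ∈ weilClassesOf B ψ k d ∧
              c' = complexBetti.map g (2 * k) w} ∪
       {c' : complexBetti X.X (2 * k) |
          ∃ (B : Motives.AbelianVariety ℂ) (g : X.X ⟶ B.X) (ψ : B ⟶ B) (P : Polynomial ℤ) (e : ℕ)
            (w : complexBetti B.X (2 * k)),
            P.Monic ∧ P.natDegree = e ∧ 2 < e ∧ Irreducible (P.map (Int.castRingHom ℚ)) ∧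
              Polynomial.eval₂ (Int.castRingHom (CategoryTheory.End B)) (ψ : CategoryTheory.End B) P = 0 ∧
              e * (2 * k) = 2 * B.dim ∧
              (∀ ρ : ℂ, Polynomial.eval₂ (Int.castRingHom ℂ) ρ P = 0 → starRingEnd ℂ ρ ≠ ρ) ∧
              (∃ Q : Polynomial ℚ, ∀ ρ : ℂ, Polynomial.eval₂ (Int.castRingHom ℂ) ρ P = 0 →
                  Polynomial.eval₂ (algebraMap ℚ ℂ) ρ Q = starRingEnd ℂ ρ) ∧
              w ∈ weilClassesField B ψ P (2 * k) ∧ IsRationalClass w ∧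
              IsOfHodgeType B.dim B.X (2 * k) k k w ∧ c' = complexBetti.map g (2 * k) w}))
    (weakTargets_pullback_stable k) s π hN hsπ
    (fun c' hc'Q hc'H => andreWeak_cmTypedProduct F hF B Φ ι θ hB k c' hc'Q hc'H) c hcQ hcH

end Summit.HodgeConjecture.CorCM.AndreWeakForm

end
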